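import Mathlib
import HarnessLib
import Summits.HubbardSuperconductivity.HubbardSuperconductivity.Theorems.KLProgrammeKLRegimeEnginePairLadderRelativeFlowResolved

/-!
# Route `KLProgramme` — ENGINE child gen 8 (stmt-HubbardSuperconductivity-20437 `KLRegimeEngineV17F2`), skeleton v2 class #5 rev 3:
# the resolved relative step door keyed on INTEGRATED RATE PROFILES — `kltc_relative_flow_duhamel_resolved_of_rates`
# (cell gate-hubbard-kl, seat hubbard-kl-k3c1-p1 g15, technique «composed-map remainder propagation»)

WHY.  `kltc_relative_flow_duhamel_resolved` (previous file) takes remaining-variation CURVES `vᵢ(t,c)` (`‖ḃᵢ(t,c)‖ ≤ −v̇ᵢ(t,c)`, `vᵢ(1) ≥ 0`).  In the model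
the member rung weights `bᵢ(t) = −B(φᵢ(t),φᵢ(t))` are NOT monotone in general (the pair sum `klBubbleMass` has a sign only on the hard / deep-pair zone,
`klBubbleMass_nonneg_of_hard_left`), so the natural supply is the INTEGRATED RATE PROFILE `∫₀¹‖ḃᵢ(τ,c)‖dτ ≤ Vᵢ(c)` — in the model `≤ klRungProfile … c`
(next file `…EnginePairTransferMemberRateVariation`, by the monotonicity of the running cutoff weight and the bilinearity of `klBubbleMaj`).  This file:
* `kltc_remainingVariation_of_rate` — from ANY entrywise-continuous rate `ḃ` on `[0,1]` the curves `v(t,c) = ∫_t^1‖ḃ(τ,c)‖dτ` (clamped to `[0,1]` so that they are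
  differentiable on all of `ℝ`): `v̇ = −‖ḃ‖` on `[0,1]`, `v(1) = 0`, `v(0,c) = ∫₀¹‖ḃ(τ,c)‖dτ`;
* **`kltc_relative_flow_duhamel_resolved_of_rates`** — the class-#5 STEP door with the `v`-rows DISCHARGED: hypotheses = those of `kltc_relative_flow_duhamel`
  (p583555) MINUS {`bᵢ`, `ρᵢ`, `β`, `mβ ≤ 1/3`, `ξ ξ₁ ξ₂ δ`, the four sup rows} PLUS {`∫₀¹‖ḃᵢ(τ,c)‖dτ ≤ Vᵢ(c)`, `m·Σ_c Vᵢ(c) ≤ 1/3`}; conclusion = the four-term form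
  `S + Σ_c S·V₂·(3m/2) + Σ_{a′}(3m/2)V₁·S + ΣΣ(3m/2)V₁·S·V₂(3m/2)` of `S ≥ ‖Ẽ(0)‖ + I`, `I ≥ ∫₀¹‖X_rel‖` (resolved).  With `Vᵢ := klRungProfile` these are EXACTLY the
  profile rows and the `m·Σρ ≤ 1/3` row the keyed step of record already discharges — so the keyed/analytic STEP over this door has today's sizes bundle minus the
  sup rows (CLASS5-RESOLVED-STEP.md §2, evidence #55 on 20437).
Real analysis over landed doors; nothing about the model is asserted; nothing asserts (X).3, (c), K3 or superconductivity.  0 kit · 0 lit.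
-/

noncomputable section

namespace Summit.HubbardSuperconductivity.HubbardSuperconductivity.Theorems.KLRegimeSplit

set_option linter.dupNamespace false -- summit = problem name (single-conjunct summit), D-0017

open Finset Matrix Set
open Summit.HubbardSuperconductivity.HubbardSuperconductivity.Theorems.KLProgrammeCooperResummation

/-! ## §1 Remaining-variation curves from a continuous rate -/

section Variation

variable {ι : Type*}

/-- **Remaining-variation curves from a continuous rate.**  For an entrywise-continuous rate `ḃ` on `[0,1]` there are curves `v(·,c)`, differentiable on `[0,1]`
(indeed on `ℝ`), with `‖ḃ(t,c)‖ ≤ −v̇(t,c)` on `[0,1]` (equality), `v(1,c) = 0` and `v(0,c) = ∫₀¹‖ḃ(τ,c)‖dτ` — namely `v(t,c) = ∫_t^1‖ḃ(τ̃,c)‖dτ`, `τ̃` = `τ` clamped to `[0,1]`. -/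
theorem kltc_remainingVariation_of_rate (b' : ℝ → ι → ℂ) (hb'c : ∀ c, ContinuousOn (fun t => b' t c) (Icc 0 1)) :
    ∃ v v' : ℝ → ι → ℝ, (∀ t ∈ Icc (0 : ℝ) 1, ∀ c, HasDerivAt (fun s => v s c) (v' t c) t) ∧
      (∀ t ∈ Icc (0 : ℝ) 1, ∀ c, ‖b' t c‖ ≤ -v' t c) ∧ (∀ c, 0 ≤ v 1 c) ∧ (∀ c, v 0 c = ∫ τ in (0 : ℝ)..1, ‖b' τ c‖) := by
  set cl : ℝ → ℝ := fun s => max 0 (min s 1) with hcl_def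
  have hcl_cont : Continuous cl := continuous_const.max (continuous_id.min continuous_const)
  have hcl_mem : ∀ s, cl s ∈ Icc (0 : ℝ) 1 := fun s => ⟨le_max_left _ _, max_le zero_le_one (min_le_right _ _)⟩
  have hcl_eq : ∀ s ∈ Icc (0 : ℝ) 1, cl s = s := fun s hs => by
    simp only [hcl_def]; rw [min_eq_left hs.2, max_eq_right hs.1]
  set f : ι → ℝ → ℝ := fun c τ => ‖b' (cl τ) c‖ with hf_def
  have hf_cont : ∀ c, Continuous (f c) := fun c => by
    have h : Continuous ((fun t => b' t c) ∘ cl) := (hb'c c).comp_continuous hcl_cont hcl_mem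
    exact h.norm
  have hf_eq : ∀ τ ∈ Icc (0 : ℝ) 1, ∀ c, f c τ = ‖b' τ c‖ := fun τ hτ c => by simp only [hf_def, hcl_eq τ hτ]
  refine ⟨fun t c => ∫ τ in t..1, f c τ, fun t c => -f c t, fun t _ c => ?_, fun t ht c => ?_, fun c => ?_, fun c => ?_⟩
  · have h := ((hf_cont c).integral_hasStrictDerivAt 1 t).hasDerivAt.neg
    have hfun : (fun s => ∫ τ in s..1, f c τ) = fun s => -∫ τ in (1 : ℝ)..s, f c τ := by
      funext s; rw [intervalIntegral.integral_symm]
    rw [hfun]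
    exact h
  · rw [neg_neg, hf_eq t ht c]
  · simp only [intervalIntegral.integral_same, le_refl]
  · exact intervalIntegral.integral_congr fun τ hτ => hf_eq τ (by rwa [Set.uIcc_of_le zero_le_one] at hτ) c

end Variation

/-! ## §2 The resolved relative step door keyed on integrated rate profiles -/

section Rates

variable {ι : Type*} [Fintype ι] [DecidableEq ι]

set_option maxHeartbeats 400000 in -- long hypothesis list; plumbing into `kltc_relative_flow_duhamel_resolved`; pre-empts the 180k cliff probe
/-- **Relative flow Duhamel, RESOLVED, keyed on integrated rate profiles (class-#5 STEP door).**  On `[0,1]`: `Ȧᵢ = −Aᵢ·diag ḃᵢ·Aᵢ + Sᵢ` (entrywise C¹;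
`ḃᵢ`, `Sᵢ` entrywise continuous), `|Aᵢ| ≤ m`; INTEGRATED RATE PROFILES `∫₀¹‖ḃᵢ(τ,c)‖dτ ≤ Vᵢ(c)` with `m·Σ_c Vᵢ(c) ≤ 1/3`; `ȧ = ḃ₁ − ḃ₂`;
`I(x,y) ≥ ∫₀¹‖X_rel(t)(x,y)‖dt` for `X_rel = S₁·(1 + diag a·A₂) + A₁·diag a·S₂ − S₂`; `S(x,y) ≥ ‖Ẽ(0)(x,y)‖ + I(x,y)` for `Ẽ = A₁ + A₁·diag a·A₂ − A₂`.  THEN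
`‖Ẽ(1)(x,y)‖ ≤ S(x,y) + Σ_c S(x,c)V₂(c)(3m/2) + Σ_{a′} (3m/2)V₁(a′)S(a′,y) + Σ_{a′}Σ_c (3m/2)V₁(a′)S(a′,c)V₂(c)(3m/2)`. -/
theorem kltc_relative_flow_duhamel_resolved_of_rates (A₁ A₁' A₂ A₂' S₁ S₂ : ℝ → Matrix ι ι ℂ) (b₁' b₂' a : ℝ → ι → ℂ)
    (V₁ V₂ : ι → ℝ) (I S : ι → ι → ℝ) {m : ℝ} (hm : 0 ≤ m)
    (hA₁ : ∀ t ∈ Icc (0 : ℝ) 1, ∀ x y, HasDerivAt (fun s => A₁ s x y) (A₁' t x y) t)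
    (hA₂ : ∀ t ∈ Icc (0 : ℝ) 1, ∀ x y, HasDerivAt (fun s => A₂ s x y) (A₂' t x y) t)
    (ha : ∀ t ∈ Icc (0 : ℝ) 1, ∀ c, HasDerivAt (fun s => a s c) (b₁' t c - b₂' t c) t)
    (hb₁'c : ∀ c, ContinuousOn (fun t => b₁' t c) (Icc 0 1)) (hb₂'c : ∀ c, ContinuousOn (fun t => b₂' t c) (Icc 0 1))
    (hS₁c : ∀ x y, ContinuousOn (fun t => S₁ t x y) (Icc 0 1)) (hS₂c : ∀ x y, ContinuousOn (fun t => S₂ t x y) (Icc 0 1))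
    (hflow₁ : ∀ t ∈ Icc (0 : ℝ) 1, A₁' t = -(A₁ t * diagonal (b₁' t) * A₁ t) + S₁ t)
    (hflow₂ : ∀ t ∈ Icc (0 : ℝ) 1, A₂' t = -(A₂ t * diagonal (b₂' t) * A₂ t) + S₂ t)
    (hA₁m : ∀ t ∈ Icc (0 : ℝ) 1, ∀ x y, ‖A₁ t x y‖ ≤ m) (hA₂m : ∀ t ∈ Icc (0 : ℝ) 1, ∀ x y, ‖A₂ t x y‖ ≤ m)
    (hV₁ : ∀ c, (∫ τ in (0 : ℝ)..1, ‖b₁' τ c‖) ≤ V₁ c) (hV₂ : ∀ c, (∫ τ in (0 : ℝ)..1, ‖b₂' τ c‖) ≤ V₂ c)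
    (hZ₁ : m * ∑ c, V₁ c ≤ 1 / 3) (hZ₂ : m * ∑ c, V₂ c ≤ 1 / 3)
    (hI : ∀ x y, (∫ t in (0 : ℝ)..1, ‖(S₁ t * (1 + diagonal (a t) * A₂ t) + A₁ t * diagonal (a t) * S₂ t - S₂ t) x y‖) ≤ I x y)
    (hS : ∀ x y, ‖(A₁ 0 + A₁ 0 * diagonal (a 0) * A₂ 0 - A₂ 0) x y‖ + I x y ≤ S x y) (x y : ι) :
    ‖(A₁ 1 + A₁ 1 * diagonal (a 1) * A₂ 1 - A₂ 1) x y‖ ≤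
      S x y + ∑ c, S x c * V₂ c * (3 / 2 * m) + ∑ a', 3 / 2 * m * V₁ a' * S a' y +
        ∑ a', ∑ c, 3 / 2 * m * V₁ a' * S a' c * V₂ c * (3 / 2 * m) := by
  obtain ⟨v₁, v₁', hv₁, hr₁, hv₁1, hv₁0⟩ := kltc_remainingVariation_of_rate b₁' hb₁'c
  obtain ⟨v₂, v₂', hv₂, hr₂, hv₂1, hv₂0⟩ := kltc_remainingVariation_of_rate b₂' hb₂'c
  -- the integrated rates are below the profiles
  have hle₁ : ∀ c, v₁ 0 c ≤ V₁ c := fun c => by rw [hv₁0 c]; exact hV₁ c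
  have hle₂ : ∀ c, v₂ 0 c ≤ V₂ c := fun c => by rw [hv₂0 c]; exact hV₂ c
  have hnn₁ : ∀ c, 0 ≤ v₁ 0 c := fun c => by
    rw [hv₁0 c]; exact intervalIntegral.integral_nonneg zero_le_one fun τ _ => norm_nonneg _
  have hnn₂ : ∀ c, 0 ≤ v₂ 0 c := fun c => by
    rw [hv₂0 c]; exact intervalIntegral.integral_nonneg zero_le_one fun τ _ => norm_nonneg _
  have hZ₁' : m * ∑ c, v₁ 0 c ≤ 1 / 3 := (mul_le_mul_of_nonneg_left (sum_le_sum fun c _ => hle₁ c) hm).trans hZ₁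
  have hZ₂' : m * ∑ c, v₂ 0 c ≤ 1 / 3 := (mul_le_mul_of_nonneg_left (sum_le_sum fun c _ => hle₂ c) hm).trans hZ₂
  -- the resolved door with these curves
  have h := kltc_relative_flow_duhamel_resolved A₁ A₁' A₂ A₂' S₁ S₂ b₁' b₂' a v₁ v₂ v₁' v₂' I S hm hA₁ hA₂ ha hS₁c hS₂c hflow₁ hflow₂
    hA₁m hA₂m hv₁ hv₂ hr₁ hr₂ hv₁1 hv₂1 hZ₁' hZ₂' hI hS x y
  -- `S ≥ 0`, so the four-term form is monotone in the profiles
  have hI0 : ∀ u w, 0 ≤ I u w := fun u w =>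
    (intervalIntegral.integral_nonneg zero_le_one fun t _ => norm_nonneg _).trans (hI u w)
  have hS0 : ∀ u w, 0 ≤ S u w := fun u w => (add_nonneg (norm_nonneg _) (hI0 u w)).trans (hS u w)
  have hV₁0 : ∀ c, 0 ≤ V₁ c := fun c => (hnn₁ c).trans (hle₁ c)
  have hm' : 0 ≤ 3 / 2 * m := by positivity
  refine h.trans ?_
  have t2 : ∑ c, S x c * v₂ 0 c * (3 / 2 * m) ≤ ∑ c, S x c * V₂ c * (3 / 2 * m) := sum_le_sum fun c _ =>
    mul_le_mul_of_nonneg_right (mul_le_mul_of_nonneg_left (hle₂ c) (hS0 x c)) hm'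
  have t3 : ∑ a', 3 / 2 * m * v₁ 0 a' * S a' y ≤ ∑ a', 3 / 2 * m * V₁ a' * S a' y := sum_le_sum fun a' _ =>
    mul_le_mul_of_nonneg_right (mul_le_mul_of_nonneg_left (hle₁ a') hm') (hS0 a' y)
  have t4 : ∑ a', ∑ c, 3 / 2 * m * v₁ 0 a' * S a' c * v₂ 0 c * (3 / 2 * m) ≤
      ∑ a', ∑ c, 3 / 2 * m * V₁ a' * S a' c * V₂ c * (3 / 2 * m) := sum_le_sum fun a' _ => sum_le_sum fun c _ => by
    have h1 : 3 / 2 * m * v₁ 0 a' * S a' c ≤ 3 / 2 * m * V₁ a' * S a' c :=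
      mul_le_mul_of_nonneg_right (mul_le_mul_of_nonneg_left (hle₁ a') hm') (hS0 a' c)
    have h0 : 0 ≤ 3 / 2 * m * V₁ a' * S a' c := mul_nonneg (mul_nonneg hm' (hV₁0 a')) (hS0 a' c)
    exact mul_le_mul_of_nonneg_right (mul_le_mul h1 (hle₂ c) (hnn₂ c) h0) hm'
  linarith

end Rates

end Summit.HubbardSuperconductivity.HubbardSuperconductivity.Theorems.KLRegimeSplit

end
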